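import Mathlib.RingTheory.KrullDimension.Regular
import Summits.Ventures.HSemireg.SpecialisationPurity
import HarnessLib

/-!
# Venture HSemireg — purity lifts along a one-parameter deformation: the two hypotheses discharged

`SpecialisationPurity.eq_bot_of_saturationClosed` (seat w1-tw-1, cell record
`widen/W1/CLEAN-COMPONENT-THEOREM-w1tw1.md` §24 l.676–677 and §20 step (2)) proves «every member of a
saturation-closed class `P` of submodules of `M` dying in `M ⧸ tM` is `0`» and leaves the two
hypotheses `hsat`, `hle` abstract. In the geometry `P N :⟺ dim Supp N ≤ d` and both hypotheses
follow from ONE input, FLATNESS over the disc = `t` is `M`-regular, plus the purity of the special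
fibre. This file discharges them in Mathlib's language (`Module.supportDim`, `IsSMulRegular`,
`QuotSMulTop t M = M ⧸ t • ⊤`):

* `supportDim_comap_lsmul_le` — `t` `M`-regular ⇒ `m ↦ t • m` embeds the saturation `(N : t)` into
  `N`, so `supportDim (N : t) ≤ supportDim N` (gives `hsat`);
* `supportDim_quotSMulTop_succ_le` — `t` `N`-regular, `N` finite ⇒ `supportDim (N ⧸ tN) + 1 ≤ supportDim N`
  (the dimension drop by a regular element, `≤` half, from Mathlib);
* `supportDim_map_mkQ_succ_le` — `t` `M`-regular, `R` Noetherian, `M` finite ⇒ the image `N̄` of `N`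
  in `M ⧸ tM` is a quotient of `N ⧸ tN`, hence `supportDim N̄ + 1 ≤ supportDim N`
  (Mathlib `Module.supportDim_quotSMulTop_succ_le_of_notMem_minimalPrimes`; gives `hle` once the
  special fibre is pure);
* `eq_bot_of_supportDim_lt` — **purity lifts**: `R` Noetherian, `M` finite, `t` in the Jacobson
  radical and `M`-regular; if `M ⧸ tM` has no non-zero submodule of support dimension `< d`, then `M`
  has no non-zero submodule of support dimension `< d + 1`.

Geometric reading (stalk at a point of the special fibre of a flat family of coherent sheaves over a
disc): if the special fibre is pure of dimension `d`, the total space is pure of dimension `d + 1`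
there. HONEST FRAMING. Elementary commutative algebra indexing one bookkeeping step of a NEGATIVE
structure theorem of the computation cell `pub-hsemireg` (W1); no scheme, sheaf, abelian variety or
semiregularity map appears; nothing here says that HC, HC_CM or HC_AV holds.
-/

namespace Summit.Ventures.HSemireg

namespace SpecialisationPurity

open Pointwise

universe u v

variable {R : Type u} [CommRing R] {M : Type v} [AddCommGroup M] [Module R M]

/-- **Saturation keeps the support bound.** If `t` is `M`-regular, `m ↦ t • m` maps the saturation
`(N : t) = N.comap (t • ·)` injectively into `N`, so `supportDim (N : t) ≤ supportDim N`.
[cite: Matsumura1987, §8] -/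
theorem supportDim_comap_lsmul_le (t : R) (reg : IsSMulRegular M t) (N : Submodule R M) :
    Module.supportDim R (N.comap (LinearMap.lsmul R M t)) ≤ Module.supportDim R N := by
  let f : N.comap (LinearMap.lsmul R M t) →ₗ[R] N :=
    ((LinearMap.lsmul R M t).domRestrict (N.comap (LinearMap.lsmul R M t))).codRestrict N
      (fun m => Submodule.mem_comap.mp m.2)
  refine Module.supportDim_le_of_injective f ?_
  intro a b hab
  apply Subtype.ext
  have h := congrArg Subtype.val hab
  simp only [f, LinearMap.codRestrict_apply, LinearMap.domRestrict_apply,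
    LinearMap.lsmul_apply] at h
  exact reg h

/-- **Dimension drop by a regular element** (the `≤` half of [Matsumura1987, §8 Thm. 8.10 / §15],
Mathlib's `Module.supportDim_quotSMulTop_succ_le_of_notMem_minimalPrimes` fed with
`IsSMulRegular.notMem_of_mem_minimalPrimes`): if `t` is `N`-regular and `N` is finite then
`supportDim (N ⧸ tN) + 1 ≤ supportDim N` (no Jacobson hypothesis is needed for this direction).
[cite: Matsumura1987, §8] -/
theorem supportDim_quotSMulTop_succ_le {N : Type v} [AddCommGroup N] [Module R N] [Module.Finite R N]
    (t : R) (reg : IsSMulRegular N t) :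
    Module.supportDim R (QuotSMulTop t N) + 1 ≤ Module.supportDim R N :=
  Module.supportDim_quotSMulTop_succ_le_of_notMem_minimalPrimes
    (fun _ => reg.notMem_of_mem_minimalPrimes)

/-- **Dimension drop in the special fibre.** `R` Noetherian, `M` finite, `t` `M`-regular: for every
submodule `N` of `M`, the image of `N` in `M ⧸ tM` is a quotient of `N ⧸ tN`, and `t` is `N`-regular,
so `supportDim (image) + 1 ≤ supportDim N` (`hle` of `eq_bot_of_saturationClosed` follows once the
special fibre is pure). [cite: Matsumura1987, §8] -/
theorem supportDim_map_mkQ_succ_le [IsNoetherianRing R] [Module.Finite R M] (t : R)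
    (reg : IsSMulRegular M t) (N : Submodule R M) :
    Module.supportDim R (N.map (t • (⊤ : Submodule R M)).mkQ) + 1 ≤ Module.supportDim R N := by
  have regN : IsSMulRegular N t := reg.submodule N t
  -- the surjection `N → N̄`
  let g : N →ₗ[R] N.map (t • (⊤ : Submodule R M)).mkQ :=
    ((t • (⊤ : Submodule R M)).mkQ.domRestrict N).codRestrict _
      (fun n => Submodule.mem_map_of_mem n.2)
  have hg : Function.Surjective g := by
    rintro ⟨q, hq⟩
    obtain ⟨n, hn, rfl⟩ := Submodule.mem_map.mp hq
    exact ⟨⟨n, hn⟩, rfl⟩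
  -- it kills `t • N`
  have hker : t • (⊤ : Submodule R N) ≤ LinearMap.ker g := by
    intro x hx
    obtain ⟨n, -, rfl⟩ := (Submodule.mem_smul_pointwise_iff_exists x t ⊤).mp hx
    rw [LinearMap.mem_ker, Subtype.ext_iff]
    simp only [g, LinearMap.codRestrict_apply, LinearMap.domRestrict_apply, Submodule.mkQ_apply,
      Submodule.coe_zero, Submodule.coe_smul, Submodule.Quotient.mk_eq_zero]
    exact Submodule.smul_mem_pointwise_smul _ t ⊤ trivial
  -- hence a surjection `N ⧸ tN → N̄`
  have hsurj : Function.Surjective ((t • (⊤ : Submodule R N)).liftQ g hker) := by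
    intro q
    obtain ⟨n, rfl⟩ := hg q
    exact ⟨Submodule.Quotient.mk n, by simp⟩
  calc Module.supportDim R (N.map (t • (⊤ : Submodule R M)).mkQ) + 1
      ≤ Module.supportDim R (QuotSMulTop t N) + 1 :=
        add_le_add (Module.supportDim_le_of_surjective _ hsurj) le_rfl
    _ ≤ Module.supportDim R N := supportDim_quotSMulTop_succ_le t regN

/-- **Purity lifts along a flat one-parameter deformation (hypotheses discharged).** `R` Noetherian,
`M` finite, `t` in the Jacobson radical of `R` and `M`-regular (flatness over the disc). If the special
fibre `M ⧸ tM` has no non-zero submodule of support dimension `< d` («pure in dimensions `< d`»), then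
`M` has no non-zero submodule of support dimension `< d + 1`. Proof: feed
`supportDim_comap_lsmul_le` (saturation-closedness) and `supportDim_map_mkQ_succ_le` + purity
(`N ≤ tM`) into `eq_bot_of_saturationClosed` (Krull). [cite: Matsumura1987, §8 Thm. 8.10] -/
theorem eq_bot_of_supportDim_lt [IsNoetherianRing R] [Module.Finite R M] (t : R)
    (ht : t ∈ (⊥ : Ideal R).jacobson) (reg : IsSMulRegular M t) (d : ℕ)
    (hpure : ∀ Q : Submodule R (QuotSMulTop t M), Module.supportDim R Q < (d : WithBot ℕ∞) → Q = ⊥)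
    (N : Submodule R M) (hN : Module.supportDim R N < (d : WithBot ℕ∞) + 1) : N = ⊥ := by
  refine eq_bot_of_saturationClosed t ((Ideal.span_singleton_le_iff_mem _).mpr ht)
    (fun N' => Module.supportDim R N' < (d : WithBot ℕ∞) + 1) ?_ ?_ N hN
  · intro N' hN'
    exact (supportDim_comap_lsmul_le t reg N').trans_lt hN'
  · intro N' hN'
    have h1 := supportDim_map_mkQ_succ_le t reg N'
    have hQ : N'.map (t • (⊤ : Submodule R M)).mkQ = ⊥ := by
      apply hpure
      rcases lt_or_ge (Module.supportDim R (N'.map (t • (⊤ : Submodule R M)).mkQ)) (d : WithBot ℕ∞)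
        with h | h
      · exact h
      · exact absurd hN' (not_lt.mpr ((add_le_add h le_rfl).trans h1))
    rw [Submodule.ideal_span_singleton_smul]
    intro n hn
    have hmem : (t • (⊤ : Submodule R M)).mkQ n ∈ N'.map (t • (⊤ : Submodule R M)).mkQ :=
      Submodule.mem_map_of_mem hn
    rw [hQ, Submodule.mem_bot, Submodule.mkQ_apply, Submodule.Quotient.mk_eq_zero] at hmem
    exact hmem

end SpecialisationPurity

end Summit.Ventures.HSemireg
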